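import Mathlib
import HarnessLib
import Literature.Analysis.FluidPDE.Tao2016AveragedNS.TaylorChainCertificate
import Summits.NavierStokesRegularity.NavierStokesRegularity.Theorems.TaylorModelRungThreeReadoutChainTools

/-!
# Line `taylor-model` on crux K1b-DR (stmt-NavierStokesRegularity-23954) — stub G4 (`LandingC1`),
# helper 2: the weighted window norm and scaling of the certificate's unit-ball clauses

Toward the registered stub `stub_landing : LandingC1` (skeleton v4 `a500375dfcc940c7`). The certificate
states its bounds through the weighted balls `cd.InBall j y N` (`|y i k| ≤ N · ω j k` on the window) and
through clauses on the UNIT ball / UNIT parallelepiped for linear maps (`Ci`, `Cm`, `σf`, `landD`). This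
file supplies

* `wn cd j x` — the weighted sup norm of a window-coordinate vector `x : Fin (nW cd) → ℝ`
  (`= ‖c ↦ x c / ω‖`), with `InBall ↔ wn ≤`, homogeneity, continuity, triangle inequality;
* generic SCALING lemmas: a bound for a homogeneous functional on the unit ball (`scale_ball`) or on the
  unit parallelepiped (`scale_par`) scales to radius `N ≥ 0` for window-supported arguments;
* homogeneity of the landing derivative `cd.landD j y v` in its direction argument.

MODEL-lattice bookkeeping only (rung TL-M3); nothing here is a statement about the Navier–Stokes equations.
-/

noncomputable section

-- the sub-problem namespace repeats the summit name by design (D-0017)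
set_option linter.dupNamespace false

namespace Summit.NavierStokesRegularity.NavierStokesRegularity.Theorems.TaylorModelReadout.G4

open scoped BigOperators
open Set Finset Literature.Analysis.FluidPDE.TaoCascade Literature.Analysis.FluidPDE.TaoCascade.TaylorChain

variable (cd : CertData)

/-! ### The weighted window norm -/

/-- Rescaling of window coordinates by the stage weights. [folklore] -/
def rescale (j : ℕ) (x : Fin (nW cd) → ℝ) : Fin (nW cd) → ℝ := fun c => x c / wW cd j c

/-- The weighted sup norm `max_c |x c| / ω_c` of a window-coordinate vector at stage `j`. [folklore] -/
def wn (j : ℕ) (x : Fin (nW cd) → ℝ) : ℝ := ‖rescale cd j x‖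

variable {cd}

/-- `rescale` is linear. [folklore] -/
theorem rescale_add (j : ℕ) (x y : Fin (nW cd) → ℝ) : rescale cd j (x + y) = rescale cd j x + rescale cd j y := by
  funext c; simp [rescale, add_div]

/-- `rescale` is homogeneous. [folklore] -/
theorem rescale_smul (j : ℕ) (a : ℝ) (x : Fin (nW cd) → ℝ) : rescale cd j (a • x) = a • rescale cd j x := by
  funext c; simp [rescale, mul_div_assoc]

/-- `rescale` is continuous. [folklore] -/
theorem continuous_rescale (j : ℕ) : Continuous (rescale cd j) := by
  refine continuous_pi fun c => ?_
  exact (continuous_apply c).div_const _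

/-- The weighted norm is nonnegative. [folklore] -/
theorem wn_nonneg (j : ℕ) (x : Fin (nW cd) → ℝ) : 0 ≤ wn cd j x := norm_nonneg _

/-- The weighted norm is continuous. [folklore] -/
theorem continuous_wn (j : ℕ) : Continuous (wn cd j) := continuous_norm.comp (continuous_rescale j)

/-- The weighted norm is absolutely homogeneous. [folklore] -/
theorem wn_smul (j : ℕ) (a : ℝ) (x : Fin (nW cd) → ℝ) : wn cd j (a • x) = |a| * wn cd j x := by
  rw [wn, rescale_smul, norm_smul, Real.norm_eq_abs, wn]

/-- Triangle inequality for the weighted norm. [folklore] -/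
theorem wn_add_le (j : ℕ) (x y : Fin (nW cd) → ℝ) : wn cd j (x + y) ≤ wn cd j x + wn cd j y := by
  rw [wn, rescale_add]; exact norm_add_le _ _

/-- The weighted norm of a difference is symmetric. [folklore] -/
theorem wn_sub_comm (j : ℕ) (x y : Fin (nW cd) → ℝ) : wn cd j (x - y) = wn cd j (y - x) := by
  rw [← neg_sub, ← neg_one_smul ℝ (y - x), wn_smul]; simp

/-- `wn (x - y) ≤ wn x + wn y`. [folklore] -/
theorem wn_sub_le (j : ℕ) (x y : Fin (nW cd) → ℝ) : wn cd j (x - y) ≤ wn cd j x + wn cd j y := by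
  have h := wn_add_le j x ((-1 : ℝ) • y)
  rw [wn_smul] at h
  simpa [sub_eq_add_neg] using h

section Pos

variable {j : ℕ} (hω : ∀ k, 0 < cd.ω j k)
include hω

/-- Coordinate bound from the weighted norm: `|x c| ≤ wn x · ω_c`. [folklore] -/
theorem abs_le_wn (x : Fin (nW cd) → ℝ) (c : Fin (nW cd)) : |x c| ≤ wn cd j x * wW cd j c := by
  have hw : 0 < wW cd j c := wW_pos cd hω c
  have h1 : |rescale cd j x c| ≤ wn cd j x := by
    rw [wn, ← Real.norm_eq_abs]; exact norm_le_pi_norm _ c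
  rw [rescale, abs_div, abs_of_pos hw, div_le_iff₀ hw] at h1
  exact h1

/-- The weighted norm is bounded by `N ≥ 0` as soon as every coordinate is `≤ N · ω_c`. [folklore] -/
theorem wn_le (x : Fin (nW cd) → ℝ) {N : ℝ} (hN : 0 ≤ N) (h : ∀ c, |x c| ≤ N * wW cd j c) : wn cd j x ≤ N := by
  rw [wn, pi_norm_le_iff_of_nonneg hN]
  intro c
  have hw : 0 < wW cd j c := wW_pos cd hω c
  rw [Real.norm_eq_abs, rescale, abs_div, abs_of_pos hw, div_le_iff₀ hw]
  exact h c

/-- `InBall j (ofVec x) (wn x)`. [folklore] -/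
theorem inBall_ofVec_wn (x : Fin (nW cd) → ℝ) : cd.InBall j (ofVec cd x) (wn cd j x) :=
  (inBall_ofVec_iff cd j x _).2 (abs_le_wn hω x)

/-- `InBall j y (wn (toVec y))`. [folklore] -/
theorem inBall_wn_toVec (y : Fin 4 → ℤ → ℝ) : cd.InBall j y (wn cd j (toVec cd y)) :=
  (inBall_iff_toVec cd j y _).2 (abs_le_wn hω _)

/-- A ball bound of radius `N ≥ 0` bounds the weighted norm of the window coordinates. [folklore] -/
theorem wn_toVec_le {y : Fin 4 → ℤ → ℝ} {N : ℝ} (hN : 0 ≤ N) (h : cd.InBall j y N) : wn cd j (toVec cd y) ≤ N :=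
  wn_le hω _ hN ((inBall_iff_toVec cd j y N).1 h)

omit hω in
/-- A window-supported state in the ball of radius `0` vanishes. [folklore] -/
theorem eq_zero_of_inBall_zero {y : Fin 4 → ℤ → ℝ} (hy : cd.Wsupp y) (h : cd.InBall j y 0) : y = 0 := by
  funext i k
  by_cases hk : -cd.Kb ≤ k ∧ k ≤ cd.Ka
  · have := h i k hk.1 hk.2
    rw [zero_mul] at this
    exact abs_nonpos_iff.1 this
  · exact hy i k hk

/-- A radius bounding a window component is nonnegative. [folklore] -/
theorem nonneg_of_inBall {y : Fin 4 → ℤ → ℝ} {N : ℝ} (h : cd.InBall j y N) {k : ℤ} (hk : -cd.Kb ≤ k ∧ k ≤ cd.Ka)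
    (i : Fin 4) : 0 ≤ N := by
  have h1 := h i k hk.1 hk.2
  have h2 := hω k
  nlinarith [abs_nonneg (y i k)]

end Pos

/-! ### Scaling of unit-ball and unit-parallelepiped clauses -/

section Scale

variable {j : ℕ}

/-- **Scaling from the unit ball.** A homogeneous real functional bounded by `C` on the unit weighted ball is
bounded by `C · N` on window-supported vectors of the ball of radius `N ≥ 0`. [folklore] -/
theorem scale_ball {f : (Fin 4 → ℤ → ℝ) → ℝ} (hf : ∀ (a : ℝ) v, f (a • v) = a * f v) {C : ℝ}
    (hC : ∀ v, cd.InBall j v 1 → |f v| ≤ C) {v : Fin 4 → ℤ → ℝ} (hv : cd.Wsupp v) {N : ℝ} (hN : 0 ≤ N)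
    (hvN : cd.InBall j v N) : |f v| ≤ C * N := by
  rcases hN.eq_or_lt with h0 | hpos
  · rw [← h0] at hvN
    have hv0 : v = 0 := eq_zero_of_inBall_zero hv hvN
    have hf0 : f 0 = 0 := by have := hf 0 0; rwa [zero_smul, zero_mul] at this
    rw [hv0, hf0, ← h0]; simp
  · have h1 : cd.InBall j (N⁻¹ • v) 1 := by
      intro i k hk1 hk2
      rw [Pi.smul_apply, Pi.smul_apply, smul_eq_mul, abs_mul, abs_of_pos (inv_pos.2 hpos), one_mul,
        inv_mul_le_iff₀ hpos]
      exact hvN i k hk1 hk2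
    have h2 := hC _ h1
    rw [hf, abs_mul, abs_of_pos (inv_pos.2 hpos), inv_mul_le_iff₀ hpos] at h2
    rw [mul_comm]; exact h2

/-- **Scaling from the unit parallelepiped.** A homogeneous real functional bounded by `C` on
`{|ξ i k| ≤ rP i k}` is bounded by `C · N` on window-supported `ξ` with `|ξ i k| ≤ N · rP i k`, `N ≥ 0`.
[folklore] -/
theorem scale_par {rP : Fin 4 → ℤ → ℝ} {f : (Fin 4 → ℤ → ℝ) → ℝ} (hf : ∀ (a : ℝ) v, f (a • v) = a * f v)
    {C : ℝ} (hC : ∀ ξ : (Fin 4 → ℤ → ℝ), (∀ i k, -cd.Kb ≤ k → k ≤ cd.Ka → |ξ i k| ≤ rP i k) → |f ξ| ≤ C)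
    {ξ : Fin 4 → ℤ → ℝ} (hξ : cd.Wsupp ξ) {N : ℝ} (hN : 0 ≤ N)
    (hξN : ∀ i k, -cd.Kb ≤ k → k ≤ cd.Ka → |ξ i k| ≤ N * rP i k) : |f ξ| ≤ C * N := by
  rcases hN.eq_or_lt with h0 | hpos
  · have hξ0 : ξ = 0 := by
      funext i k
      by_cases hk : -cd.Kb ≤ k ∧ k ≤ cd.Ka
      · have := hξN i k hk.1 hk.2
        rw [← h0, zero_mul] at this
        exact abs_nonpos_iff.1 this
      · exact hξ i k hk
    have hf0 : f 0 = 0 := by have := hf 0 0; rwa [zero_smul, zero_mul] at this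
    rw [hξ0, hf0, ← h0]; simp
  · have h1 : ∀ i k, -cd.Kb ≤ k → k ≤ cd.Ka → |(N⁻¹ • ξ) i k| ≤ rP i k := by
      intro i k hk1 hk2
      rw [Pi.smul_apply, Pi.smul_apply, smul_eq_mul, abs_mul, abs_of_pos (inv_pos.2 hpos),
        inv_mul_le_iff₀ hpos]
      exact hξN i k hk1 hk2
    have h2 := hC _ h1
    rw [hf, abs_mul, abs_of_pos (inv_pos.2 hpos), inv_mul_le_iff₀ hpos] at h2
    rw [mul_comm]; exact h2

/-- Vector form of `scale_ball`: a linear map sending the unit ball into `InBall j · R`-type componentwise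
bounds `|g v i k| ≤ C i k` sends window-supported `v ∈ Ball(N)` to `|g v i k| ≤ C i k · N`. [folklore] -/
theorem scale_ball_apply {g : (Fin 4 → ℤ → ℝ) → (Fin 4 → ℤ → ℝ)} (hg : IsLinearMap ℝ g)
    {C : Fin 4 → ℤ → ℝ}
    (hC : ∀ v, cd.InBall j v 1 → ∀ i k, -cd.Kb ≤ k → k ≤ cd.Ka → |g v i k| ≤ C i k)
    {v : Fin 4 → ℤ → ℝ} (hv : cd.Wsupp v) {N : ℝ} (hN : 0 ≤ N) (hvN : cd.InBall j v N)
    (i : Fin 4) {k : ℤ} (hk : -cd.Kb ≤ k ∧ k ≤ cd.Ka) : |g v i k| ≤ C i k * N :=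
  scale_ball (f := fun v => g v i k) (fun a v => by rw [hg.map_smul]; rfl)
    (fun v hv1 => hC v hv1 i k hk.1 hk.2) hv hN hvN

/-- Vector form of `scale_par`. [folklore] -/
theorem scale_par_apply {rP : Fin 4 → ℤ → ℝ} {g : (Fin 4 → ℤ → ℝ) → (Fin 4 → ℤ → ℝ)} (hg : IsLinearMap ℝ g)
    {C : Fin 4 → ℤ → ℝ}
    (hC : ∀ ξ : (Fin 4 → ℤ → ℝ), (∀ i k, -cd.Kb ≤ k → k ≤ cd.Ka → |ξ i k| ≤ rP i k) →
      ∀ i k, -cd.Kb ≤ k → k ≤ cd.Ka → |g ξ i k| ≤ C i k)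
    {ξ : Fin 4 → ℤ → ℝ} (hξ : cd.Wsupp ξ) {N : ℝ} (hN : 0 ≤ N)
    (hξN : ∀ i k, -cd.Kb ≤ k → k ≤ cd.Ka → |ξ i k| ≤ N * rP i k)
    (i : Fin 4) {k : ℤ} (hk : -cd.Kb ≤ k ∧ k ≤ cd.Ka) : |g ξ i k| ≤ C i k * N :=
  scale_par (f := fun v => g v i k) (fun a v => by rw [hg.map_smul]; rfl)
    (fun ξ h => hC ξ h i k hk.1 hk.2) hξ hN hξN

end Scale

/-! ### The landing derivative is linear in its direction -/

/-- `landD j y v` is homogeneous in the direction `z`. [folklore] -/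
theorem landD_smul (j : ℕ) (y : Fin 4 → ℤ → ℝ) (v : Fin 4 → ℝ) (a : ℝ) (z : Fin 4 → ℤ → ℝ) :
    cd.landD j y v (a • z) = a • cd.landD j y v z := by
  funext i k
  simp only [CertData.landD, Pi.smul_apply, smul_eq_mul]
  by_cases hk : k + 1 ≤ cd.Ka
  · simp only [hk, ↓reduceIte]; ring
  · simp only [hk, ↓reduceIte]; ring

/-- `landD j y v` is additive in the direction `z`. [folklore] -/
theorem landD_add (j : ℕ) (y : Fin 4 → ℤ → ℝ) (v : Fin 4 → ℝ) (z z' : Fin 4 → ℤ → ℝ) :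
    cd.landD j y v (z + z') = cd.landD j y v z + cd.landD j y v z' := by
  funext i k
  simp only [CertData.landD, Pi.add_apply]
  by_cases hk : k + 1 ≤ cd.Ka
  · simp only [hk, ↓reduceIte]; ring
  · simp only [hk, ↓reduceIte]; ring

end Summit.NavierStokesRegularity.NavierStokesRegularity.Theorems.TaylorModelReadout.G4

end
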